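import Summits.QuantumAdvantage.QuantumAdvantage.Theorems.NearExactIsExact.Negative.ReflectedPairIdentity

/-!
# `NearExactIsExact` (stmt-QuantumAdvantage-14043) — negative lemma THEOREM ZP (gen 42, part 2/2):
  zero-section parity of a twisted affine frame, in closed form

**Context.** See part 1 (`Negative.ReflectedPairIdentity`). In the gen-36/39 normal form of the last
Maiorana–McFarland habitat of `NearExactIsExact` the surviving maps are
`π(u,w) = (γ u, B(u) ⊕ M(u)·w)` over the `6`-bit frame `u`, `γ` affine except ONE coordinate `i₀` of
degree `≤ 2`, `B` quadratic, `M(u)` an affine family of invertible matrices whose inverse family is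
affine as well ("inversion-linear frames": all `177` census families of DISPROOF.md §47).

**What this file proves (all `r`, all such frames, no computation).** If the residual identity
`c₁(u,w) ⊕ c₂(γu, w') = 1_{u=0}` holds on the zero section (`w = 0`, `w' = B u`) and on `r` AFFINE
sections `w = tsec_a(u)` hitting the fibre points `w' = B u ⊕ e_a` (for a frame: `tsec_a = M⁻¹ e_a`),
then THEOREM ZP (`zeroSection_parity`): `Σ_u Σ_{|T|=2} B_T(u) · C_T(γ u) = 1`, `C_T = coefC c₂ T`;
`c₁` is eliminated (its zero section is cubic of even weight, its sections give degree-`5` products).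
Base-map-free form (`zeroSection_identity`, ANY `γ : 𝔽₂⁶ → 𝔽₂⁶`):
`Σ_u c₂(γu, 0) + Σ_u Σ_{|T|=2} B_T(u)·C_T(γu) = 1` — a top-coefficient identity constraining the
skew-type maps of every `naff`-stratum of BQ-11, not only `naff = 5`.
Closed form (`zeroSection_parity_closed`, Shannon expansion of the affine `C_T` in the twisted
coordinate): `Σ_{|T|=2} e_T · |{u : B_T(u) γ_{i₀}(u) = 1}| ≡ 1 (mod 2)`, where
`e_T = C_T(0) ⊕ C_T(δ_{i₀})` is the coefficient of `x_{i₀} s_T` in `c₂` — a condition on the sextic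
top forms `B_a ∧ B_b ∧ γ_{i₀}` and `C(r,2)` bits of `c₂` only. Corollaries: no configuration when
every pair coefficient of `c₂` is untwisted (`residual_ne_flat_of_untwisted_pairs`), nor when every
product `B_a B_b γ_{i₀}` has even weight (`residual_ne_flat_of_even_products`); and the frame version
`frame_zeroSection_parity` for ANY fibre action `w ↦ act u w` fixing `0` whose unit vectors have
affine preimage sections (matrix frames `I + N(u)` with an affine right-inverse family `I + N'(u)`) —
it contains the setting of THEOREM TT (`N = N' = 0`, where PAIR₂ then forces the sum to vanish) and
applies verbatim to every inversion-linear census family (DISPROOF.md §48).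

HONEST FRAMING: the value here is a THEOREM (a kernel-checked, census-free necessary condition on the
last Maiorana–McFarland habitat of `NearExactIsExact`; one-sided: it constrains, it does not decide),
NOT summit progress; the crux and the summit are untouched.
-/

set_option linter.dupNamespace false -- D-0017: single-problem summit ⇒ `QuantumAdvantage.QuantumAdvantage` by design

namespace Summit.QuantumAdvantage.QuantumAdvantage.Theorems.NearExactIsExact.Negative.ZeroSectionParity


open Finset
open Literature.Computability.QuantumComplexity
open Literature.Computability.QuantumComplexity.BuzetChailloux (bxor)
open Summit.QuantumAdvantage.QuantumAdvantage.Theorems.CubicForrelation.NearExactIsExact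
  (fc_isDegLeFun_comp stub_derivDegree tc_const_of_deg_zero fc_deg_bxor te_isDegLeFun_band)
open Summit.QuantumAdvantage.QuantumAdvantage.Theorems.NearExactIsExact.Negative.SkewProductCore
open Summit.QuantumAdvantage.QuantumAdvantage.Theorems.NearExactIsExact.Negative.SkewProductResidual
open Summit.QuantumAdvantage.QuantumAdvantage.Theorems.NearExactIsExact.Negative.TwistedTranslation
open Summit.QuantumAdvantage.QuantumAdvantage.Theorems.NearExactIsExact.Negative.UntwistedSection (sum_ind_delta)
open Summit.QuantumAdvantage.QuantumAdvantage.Theorems.NearExactIsExact.Negative.ReflectedPairIdentity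

variable {r : ℕ}

/-! ### The two degree facts fed by `c₁` -/

/-- On the zero section `c₂(γu, B u) ⊕ 1_{u=0} = c₁(u, 0)` is cubic. [folklore] -/
theorem zeroSection_deg (γ : (Fin 6 → Bool) → (Fin 6 → Bool)) (B : Fin r → (Fin 6 → Bool) → Bool)
    (c₁ c₂ : (Fin (6 + r) → Bool) → Bool) (h₁ : IsDegLeFun 3 c₁)
    (h0 : ∀ u, (c₁ (Fin.append u (fun _ => false)) ^^ c₂ (Fin.append (γ u) (fun k => B k u))) =
      decide (∀ i, u i = false)) :
    IsDegLeFun 3 (fun u => c₂ (Fin.append (γ u) (fun k => B k u)) ^^ decide (∀ i, u i = false)) := by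
  have e : (fun u => c₂ (Fin.append (γ u) (fun k => B k u)) ^^ decide (∀ i, u i = false)) =
      fun u => c₁ (Fin.append u (fun _ => false)) := by
    funext u
    exact bool_aux1 _ _ _ (h0 u)
  rw [e]
  exact fc_isDegLeFun_comp h₁ (fun u => Fin.append u (fun _ => false))
    (section_coord_deg (fun _ _ => false) (fun _ => isDegLeFun_const 1 false)) (by norm_num)

/-- Along an affine section through `B u ⊕ e_a`:
`B_a(u)·(c₂(γu, Bu) ⊕ c₂(γu, Bu ⊕ e_a)) = B_a(u)·(c₁(u,0) ⊕ c₁(u, tsec_a u))` has degree `≤ 2 + 3`.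
[folklore] -/
theorem section_deg (γ : (Fin 6 → Bool) → (Fin 6 → Bool)) (B : Fin r → (Fin 6 → Bool) → Bool)
    (hB : ∀ k, IsDegLeFun 2 (B k)) (c₁ c₂ : (Fin (6 + r) → Bool) → Bool) (h₁ : IsDegLeFun 3 c₁)
    (a : Fin r) (t : (Fin 6 → Bool) → Fin r → Bool) (ht : ∀ k, IsDegLeFun 1 (fun u => t u k))
    (h0 : ∀ u, (c₁ (Fin.append u (fun _ => false)) ^^ c₂ (Fin.append (γ u) (fun k => B k u))) =
      decide (∀ i, u i = false))
    (hsec : ∀ u, (c₁ (Fin.append u (t u)) ^^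
      c₂ (Fin.append (γ u) (fun k => decide (k = a) ^^ B k u))) = decide (∀ i, u i = false)) :
    IsDegLeFun 5 (fun u => B a u &&
      (c₂ (Fin.append (γ u) (fun k => B k u)) ^^ c₂ (Fin.append (γ u) (fun k => decide (k = a) ^^ B k u)))) := by
  have e : (fun u => B a u && (c₂ (Fin.append (γ u) (fun k => B k u)) ^^
      c₂ (Fin.append (γ u) (fun k => decide (k = a) ^^ B k u)))) =
      fun u => B a u && (c₁ (Fin.append u (fun _ => false)) ^^ c₁ (Fin.append u (t u))) := by
    funext u
    rw [bool_aux2 _ _ _ _ _ (h0 u) (hsec u)]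
  rw [e]
  have hc0 : IsDegLeFun 3 (fun u => c₁ (Fin.append u (fun _ => false))) :=
    fc_isDegLeFun_comp h₁ (fun u => Fin.append u (fun _ => false))
      (section_coord_deg (fun _ _ => false) (fun _ => isDegLeFun_const 1 false)) (by norm_num)
  have hca : IsDegLeFun 3 (fun u => c₁ (Fin.append u (t u))) :=
    fc_isDegLeFun_comp h₁ (fun u => Fin.append u (t u)) (section_coord_deg t ht) (by norm_num)
  exact te_isDegLeFun_band (hB a) (fc_deg_bxor hc0 hca)

/-! ### THEOREM ZP -/

/-- **THEOREM ZP, base-map-free form (gen 42).** For ANY base map `γ : 𝔽₂⁶ → 𝔽₂⁶` (no degree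
hypothesis), `B_k` quadratic, `c₁, c₂` cubic and affine sections `tsec_a` with the residual identity
on the zero section and on the `r` sections (as in `zeroSection_parity`):
`Σ_u c₂(γu, 0) + Σ_u Σ_{|T|=2} B_T(u)·C_T(γu) = 1` in `𝔽₂` — the top coefficient `[u₀⋯u₅]` of
`c₂(γu, 0) ⊕ ⨁_{|T|=2} B_T·(C_T ∘ γ)` is `1`, with `C_T` AFFINE (`coefC_deg`). For the skew-type
maps `π(u,w) = (γ u, B u ⊕ M(u) w)` of the D2 normal form (`M⁻¹` affine) this constrains every
`naff`-stratum of BQ-11, not only `naff = 5` (DISPROOF.md §48). [folklore] -/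
theorem zeroSection_identity (γ : (Fin 6 → Bool) → (Fin 6 → Bool))
    (B : Fin r → (Fin 6 → Bool) → Bool) (hB : ∀ k, IsDegLeFun 2 (B k))
    (c₁ c₂ : (Fin (6 + r) → Bool) → Bool) (h₁ : IsDegLeFun 3 c₁) (h₂ : IsDegLeFun 3 c₂)
    (tsec : Fin r → (Fin 6 → Bool) → Fin r → Bool) (htsec : ∀ a k, IsDegLeFun 1 (fun u => tsec a u k))
    (h0 : ∀ u, (c₁ (Fin.append u (fun _ => false)) ^^ c₂ (Fin.append (γ u) (fun k => B k u))) =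
      decide (∀ i, u i = false))
    (hsec : ∀ a u, (c₁ (Fin.append u (tsec a u)) ^^
      c₂ (Fin.append (γ u) (fun k => decide (k = a) ^^ B k u))) = decide (∀ i, u i = false)) :
    ∑ u, ind (c₂ (Fin.append (γ u) (fun _ => false))) +
      ∑ u, ∑ T ∈ (univ : Finset (Fin r)).powersetCard 2,
        (∏ m ∈ T, ind (B m u)) * ind (coefC c₂ T (γ u)) = 1 := by
  have hid : ∀ u : Fin 6 → Bool, ind (c₂ (Fin.append (γ u) (fun _ => false))) =
      ind (c₂ (Fin.append (γ u) (fun k => B k u))) +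
      ∑ a, ind (B a u) * ind (c₂ (Fin.append (γ u) (fun k => B k u)) ^^
        c₂ (Fin.append (γ u) (fun k => decide (k = a) ^^ B k u))) +
      ∑ T ∈ (univ : Finset (Fin r)).powersetCard 2, (∏ m ∈ T, ind (B m u)) * ind (coefC c₂ T (γ u)) :=
    fun u => reflected_pair_identity c₂ h₂ (γ u) (fun k => B k u)
  have hsum := sum_congr rfl fun u (_ : u ∈ (univ : Finset (Fin 6 → Bool))) => hid u
  rw [sum_add_distrib, sum_add_distrib] at hsum
  -- (Z) the zero-section term has odd weight
  have hZ' : ∑ u, ind (c₂ (Fin.append (γ u) (fun k => B k u))) = 1 := by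
    have hz := sum_ind_eq_zero_of_deg_five ((zeroSection_deg γ B c₁ c₂ h₁ h0).mono (by norm_num))
    have e : ∀ u : Fin 6 → Bool, ind (c₂ (Fin.append (γ u) (fun k => B k u))) =
        ind (c₂ (Fin.append (γ u) (fun k => B k u)) ^^ decide (∀ i, u i = false)) +
          ind (decide (∀ i, u i = false)) := by
      intro u
      rw [ind_xor]
      generalize ind (c₂ (Fin.append (γ u) fun k => B k u)) = p
      generalize ind (decide (∀ i, u i = false)) = q
      rw [add_assoc, CharTwo.add_self_eq_zero, add_zero]
    rw [sum_congr rfl (fun u _ => e u), sum_add_distrib, hz, sum_ind_delta, zero_add]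
  -- (S) each section term has even weight
  have hS' : ∑ u, ∑ a, ind (B a u) * ind (c₂ (Fin.append (γ u) (fun k => B k u)) ^^
      c₂ (Fin.append (γ u) (fun k => decide (k = a) ^^ B k u))) = 0 := by
    rw [sum_comm]
    refine sum_eq_zero fun a _ => ?_
    have hz := sum_ind_eq_zero_of_deg_five
      (section_deg γ B hB c₁ c₂ h₁ a (tsec a) (htsec a) h0 (hsec a))
    simpa only [ind_and] using hz
  rw [hZ', hS'] at hsum
  have fin : ∀ A X : ZMod 2, A = 1 + 0 + X → A + X = 1 := by decide
  exact fin _ _ hsum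

/-- **THEOREM ZP (gen 42).** `γ : 𝔽₂⁶ → 𝔽₂⁶` affine except one coordinate `i₀` of degree `≤ 2`,
`B_k` quadratic (`k < r`), `c₁, c₂` cubic on `6 + r` bits, `tsec_a : 𝔽₂⁶ → 𝔽₂^r` AFFINE sections
(`a < r`). If the residual identity `c₁(u, w) ⊕ c₂(γ u, w') = 1_{u=0}` holds on the zero section
(`w = 0`, `w' = B u`) and on the `r` sections (`w = tsec_a u`, `w' = B u ⊕ e_a`) — as it does for
`c₁ ⊕ c₂ ∘ π = 1_{u=0}` with `π(u,w) = (γ u, B u ⊕ M(u) w)`, `tsec_a = M⁻¹ e_a` — then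
`Σ_{u ∈ 𝔽₂⁶} Σ_{|T| = 2} B_T(u) · C_T(γ u) = 1` in `𝔽₂`, `C_T = coefC c₂ T` the pair coefficients of
`c₂` at the zero section (`c₂(γu, 0)` has degree `≤ 4`, even weight). `c₁` is eliminated.
(DISPROOF.md §48.) [folklore] -/
theorem zeroSection_parity (γ : (Fin 6 → Bool) → (Fin 6 → Bool)) (i₀ : Fin 6)
    (hγa : ∀ i, i ≠ i₀ → IsDegLeFun 1 (fun u => γ u i)) (hγq : IsDegLeFun 2 (fun u => γ u i₀))
    (B : Fin r → (Fin 6 → Bool) → Bool) (hB : ∀ k, IsDegLeFun 2 (B k))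
    (c₁ c₂ : (Fin (6 + r) → Bool) → Bool) (h₁ : IsDegLeFun 3 c₁) (h₂ : IsDegLeFun 3 c₂)
    (tsec : Fin r → (Fin 6 → Bool) → Fin r → Bool) (htsec : ∀ a k, IsDegLeFun 1 (fun u => tsec a u k))
    (h0 : ∀ u, (c₁ (Fin.append u (fun _ => false)) ^^ c₂ (Fin.append (γ u) (fun k => B k u))) =
      decide (∀ i, u i = false))
    (hsec : ∀ a u, (c₁ (Fin.append u (tsec a u)) ^^
      c₂ (Fin.append (γ u) (fun k => decide (k = a) ^^ B k u))) = decide (∀ i, u i = false)) :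
    ∑ u, ∑ T ∈ (univ : Finset (Fin r)).powersetCard 2,
      (∏ m ∈ T, ind (B m u)) * ind (coefC c₂ T (γ u)) = 1 :=
  zeroSection_core γ i₀ hγa hγq B c₂ h₂ ((zeroSection_deg γ B c₁ c₂ h₁ h0).mono (by norm_num))
    (fun a => section_deg γ B hB c₁ c₂ h₁ a (tsec a) (htsec a) h0 (hsec a))

/-! ### Closed form: Shannon expansion in the twisted coordinate -/

/-- For `|T| = 2` the pair coefficient `C_T` is affine, so `C_T(γ u) = C_T(γ⁰ u) ⊕ γ_{i₀}(u)·e_T`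
with `γ⁰` affine and `e_T = C_T(0) ⊕ C_T(δ_{i₀})`; the product with the quartic `B_T` of the first
term has degree `≤ 5`, even weight. Hence `Σ_u B_T(u) C_T(γu) = e_T · Σ_u B_T(u) γ_{i₀}(u)`.
[folklore] -/
theorem pair_sum_closed (γ : (Fin 6 → Bool) → (Fin 6 → Bool)) (i₀ : Fin 6)
    (hγa : ∀ i, i ≠ i₀ → IsDegLeFun 1 (fun u => γ u i))
    (B : Fin r → (Fin 6 → Bool) → Bool) (hB : ∀ k, IsDegLeFun 2 (B k))
    (c₂ : (Fin (6 + r) → Bool) → Bool) (h₂ : IsDegLeFun 3 c₂)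
    (T : Finset (Fin r)) (hT2 : T.card = 2) :
    ∑ u, (∏ m ∈ T, ind (B m u)) * ind (coefC c₂ T (γ u)) =
      ind (coefC c₂ T (fun _ => false) ^^ coefC c₂ T (fun i => decide (i = i₀))) *
        ∑ u, (∏ m ∈ T, ind (B m u)) * ind (γ u i₀) := by
  have hf : IsDegLeFun 1 (coefC c₂ T) := by simpa [hT2] using coefC_deg c₂ h₂ T
  -- Shannon expansion of the affine `C_T` in coordinate `i₀`
  have haff : ∀ i : Fin 6, IsDegLeFun 1 (fun u => Function.update (γ u) i₀ false i) := by
    intro i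
    by_cases hi : i = i₀
    · have e : (fun u => Function.update (γ u) i₀ false i) = fun _ => false :=
        funext fun u => by simp [hi]
      rw [e]; exact isDegLeFun_const 1 false
    · have e : (fun u => Function.update (γ u) i₀ false i) = fun u => γ u i :=
        funext fun u => by simp [hi]
      rw [e]; exact hγa i hi
  have hD : IsDegLeFun 0 (fun v => coefC c₂ T v ^^ coefC c₂ T (bxor v (fun i => decide (i = i₀)))) :=
    stub_derivDegree 6 0 (coefC c₂ T) _ hf
  have hflip : ∀ u, bxor (Function.update (γ u) i₀ false) (fun i => decide (i = i₀)) =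
      Function.update (γ u) i₀ true := by
    intro u; funext i
    by_cases hi : i = i₀
    · subst hi; simp [bxor]
    · simp [bxor, hi]
  have hzero : bxor (fun _ : Fin 6 => false) (fun i => decide (i = i₀)) = fun i => decide (i = i₀) := by
    funext i; simp [bxor]
  have hconst : ∀ u, (coefC c₂ T (Function.update (γ u) i₀ false) ^^
      coefC c₂ T (Function.update (γ u) i₀ true)) =
      (coefC c₂ T (fun _ => false) ^^ coefC c₂ T (fun i => decide (i = i₀))) := by
    intro u
    have h := tc_const_of_deg_zero hD (Function.update (γ u) i₀ false) (fun _ => false)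
    rw [hflip u, hzero] at h
    exact h
  have e : ∀ u, ind (coefC c₂ T (γ u)) = ind (coefC c₂ T (Function.update (γ u) i₀ false)) +
      ind (γ u i₀) * ind (coefC c₂ T (fun _ => false) ^^ coefC c₂ T (fun i => decide (i = i₀))) := by
    intro u
    rw [← hconst u, ← ind_and, ← ind_xor]
    congr 1
    cases h : γ u i₀
    · have hu : Function.update (γ u) i₀ false = γ u := by rw [← h, Function.update_eq_self]
      rw [hu]; simp
    · have hu : Function.update (γ u) i₀ true = γ u := by rw [← h, Function.update_eq_self]
      rw [hu]
      generalize coefC c₂ T (Function.update (γ u) i₀ false) = p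
      generalize coefC c₂ T (γ u) = q
      cases p <;> cases q <;> rfl
  -- the untwisted part `B_T · (C_T ∘ γ⁰)` has degree ≤ 4 + 1: even weight
  have hev : ∑ u, (∏ m ∈ T, ind (B m u)) * ind (coefC c₂ T (Function.update (γ u) i₀ false)) = 0 := by
    have hP : IsDegLeFun 4 (fun u => decide ((∏ m ∈ T, ind (B m u)) = 1)) := by
      simpa [hT2] using isDegLeFun_prod (fun m => B m) T (fun m _ => hB m)
    have hC : IsDegLeFun 1 (fun u => coefC c₂ T (Function.update (γ u) i₀ false)) :=
      fc_isDegLeFun_comp hf (fun u => Function.update (γ u) i₀ false) haff (by norm_num)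
    have h0 := sum_ind_eq_zero_of_deg_five (te_isDegLeFun_band hP hC)
    simpa only [ind_and, ind_decide_eq_one] using h0
  rw [sum_congr rfl (fun u _ => by rw [e u, mul_add]), sum_add_distrib, hev, zero_add, mul_sum]
  exact sum_congr rfl fun u _ => by ring

/-- **THEOREM ZP, closed form (gen 42).** Under the hypotheses of `zeroSection_parity`:
`Σ_{|T| = 2} e_T · |{u ∈ 𝔽₂⁶ : B_T(u)·γ_{i₀}(u) = 1}| ≡ 1 (mod 2)`, where
`e_T = C_T(0) ⊕ C_T(δ_{i₀})` is the coefficient of the monomial `x_{i₀} s_T` in `c₂` — a condition on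
the top (sextic) forms `B_a ∧ B_b ∧ γ_{i₀}` and `C(r,2)` bits of `c₂` only. (DISPROOF.md §48.)
[folklore] -/
theorem zeroSection_parity_closed (γ : (Fin 6 → Bool) → (Fin 6 → Bool)) (i₀ : Fin 6)
    (hγa : ∀ i, i ≠ i₀ → IsDegLeFun 1 (fun u => γ u i)) (hγq : IsDegLeFun 2 (fun u => γ u i₀))
    (B : Fin r → (Fin 6 → Bool) → Bool) (hB : ∀ k, IsDegLeFun 2 (B k))
    (c₁ c₂ : (Fin (6 + r) → Bool) → Bool) (h₁ : IsDegLeFun 3 c₁) (h₂ : IsDegLeFun 3 c₂)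
    (tsec : Fin r → (Fin 6 → Bool) → Fin r → Bool) (htsec : ∀ a k, IsDegLeFun 1 (fun u => tsec a u k))
    (h0 : ∀ u, (c₁ (Fin.append u (fun _ => false)) ^^ c₂ (Fin.append (γ u) (fun k => B k u))) =
      decide (∀ i, u i = false))
    (hsec : ∀ a u, (c₁ (Fin.append u (tsec a u)) ^^
      c₂ (Fin.append (γ u) (fun k => decide (k = a) ^^ B k u))) = decide (∀ i, u i = false)) :
    ∑ T ∈ (univ : Finset (Fin r)).powersetCard 2,
      ind (coefC c₂ T (fun _ => false) ^^ coefC c₂ T (fun i => decide (i = i₀))) *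
        ∑ u, (∏ m ∈ T, ind (B m u)) * ind (γ u i₀) = 1 := by
  have h := zeroSection_parity γ i₀ hγa hγq B hB c₁ c₂ h₁ h₂ tsec htsec h0 hsec
  rw [sum_comm] at h
  rw [← h]
  exact sum_congr rfl fun T hT =>
    (pair_sum_closed γ i₀ hγa B hB c₂ h₂ T (mem_powersetCard.mp hT).2).symm

/-! ### Kills -/

/-- **COROLLARY ZP-e.** If no pair coefficient of `c₂` is twisted (`C_T(δ_{i₀}) = C_T(0)` for all
`|T| = 2`, e.g. `c₂` has no monomial `x_{i₀} s_a s_b`), the residual is not `1_{u=0}` on the zero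
section and `r` affine sections simultaneously — for every `γ, B, c₁` as in THEOREM ZP. [folklore] -/
theorem residual_ne_flat_of_untwisted_pairs (γ : (Fin 6 → Bool) → (Fin 6 → Bool)) (i₀ : Fin 6)
    (hγa : ∀ i, i ≠ i₀ → IsDegLeFun 1 (fun u => γ u i)) (hγq : IsDegLeFun 2 (fun u => γ u i₀))
    (B : Fin r → (Fin 6 → Bool) → Bool) (hB : ∀ k, IsDegLeFun 2 (B k))
    (c₁ c₂ : (Fin (6 + r) → Bool) → Bool) (h₁ : IsDegLeFun 3 c₁) (h₂ : IsDegLeFun 3 c₂)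
    (he : ∀ T : Finset (Fin r), T.card = 2 →
      coefC c₂ T (fun i => decide (i = i₀)) = coefC c₂ T (fun _ => false))
    (tsec : Fin r → (Fin 6 → Bool) → Fin r → Bool) (htsec : ∀ a k, IsDegLeFun 1 (fun u => tsec a u k))
    (h0 : ∀ u, (c₁ (Fin.append u (fun _ => false)) ^^ c₂ (Fin.append (γ u) (fun k => B k u))) =
      decide (∀ i, u i = false)) :
    ¬ ∀ a u, (c₁ (Fin.append u (tsec a u)) ^^
      c₂ (Fin.append (γ u) (fun k => decide (k = a) ^^ B k u))) = decide (∀ i, u i = false) := by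
  intro hsec
  have h := zeroSection_parity_closed γ i₀ hγa hγq B hB c₁ c₂ h₁ h₂ tsec htsec h0 hsec
  have hz : ∀ T ∈ (univ : Finset (Fin r)).powersetCard 2,
      ind (coefC c₂ T (fun _ => false) ^^ coefC c₂ T (fun i => decide (i = i₀))) *
        ∑ u, (∏ m ∈ T, ind (B m u)) * ind (γ u i₀) = 0 := by
    intro T hT
    rw [he T (mem_powersetCard.mp hT).2, Bool.xor_self, ind_false, zero_mul]
  rw [sum_eq_zero hz] at h
  exact zero_ne_one h

/-- **COROLLARY ZP-w.** If every product `B_a · B_b · γ_{i₀}` (`a ≠ b`) has EVEN weight on `𝔽₂⁶`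
(e.g. its top sextic form vanishes), no cubics `c₁, c₂` realise the residual `1_{u=0}` on the zero
section and `r` affine sections simultaneously. [folklore] -/
theorem residual_ne_flat_of_even_products (γ : (Fin 6 → Bool) → (Fin 6 → Bool)) (i₀ : Fin 6)
    (hγa : ∀ i, i ≠ i₀ → IsDegLeFun 1 (fun u => γ u i)) (hγq : IsDegLeFun 2 (fun u => γ u i₀))
    (B : Fin r → (Fin 6 → Bool) → Bool) (hB : ∀ k, IsDegLeFun 2 (B k))
    (hw : ∀ T : Finset (Fin r), T.card = 2 → ∑ u, (∏ m ∈ T, ind (B m u)) * ind (γ u i₀) = 0)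
    (c₁ c₂ : (Fin (6 + r) → Bool) → Bool) (h₁ : IsDegLeFun 3 c₁) (h₂ : IsDegLeFun 3 c₂)
    (tsec : Fin r → (Fin 6 → Bool) → Fin r → Bool) (htsec : ∀ a k, IsDegLeFun 1 (fun u => tsec a u k))
    (h0 : ∀ u, (c₁ (Fin.append u (fun _ => false)) ^^ c₂ (Fin.append (γ u) (fun k => B k u))) =
      decide (∀ i, u i = false)) :
    ¬ ∀ a u, (c₁ (Fin.append u (tsec a u)) ^^
      c₂ (Fin.append (γ u) (fun k => decide (k = a) ^^ B k u))) = decide (∀ i, u i = false) := by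
  intro hsec
  have h := zeroSection_parity_closed γ i₀ hγa hγq B hB c₁ c₂ h₁ h₂ tsec htsec h0 hsec
  have hz : ∀ T ∈ (univ : Finset (Fin r)).powersetCard 2,
      ind (coefC c₂ T (fun _ => false) ^^ coefC c₂ T (fun i => decide (i = i₀))) *
        ∑ u, (∏ m ∈ T, ind (B m u)) * ind (γ u i₀) = 0 := by
    intro T hT
    rw [hw T (mem_powersetCard.mp hT).2, mul_zero]
  rw [sum_eq_zero hz] at h
  exact zero_ne_one h

/-! ### Frames: `π(u,w) = (γ u, B u ⊕ act u w)` -/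

/-- **THEOREM ZP for frames (gen 42).** `γ` affine except coordinate `i₀` of degree `≤ 2`, `B_k`
quadratic, `act u : 𝔽₂^r → 𝔽₂^r` ANY fibre action fixing `0` whose unit vectors have AFFINE
preimage sections `tsec_a` (`act u (tsec_a u) = e_a`; for a matrix frame `act u w = (I + N(u))·w`
with a right-inverse family `I + N'(u)` of affine entries take `tsec_a u = (I + N'(u)) e_a` — every
inversion-linear frame of the BQ-11 census, DISPROOF.md §47–§48; `N = N' = 0` is the setting of
THEOREM TT), `c₁, c₂` cubic with `c₁(u,w) ⊕ c₂(γ u, B u ⊕ act u w) = 1_{u=0}` everywhere. Then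
`Σ_{|T|=2} e_T · |{u : B_T(u) γ_{i₀}(u) = 1}| ≡ 1 (mod 2)`. [folklore] -/
theorem frame_zeroSection_parity (γ : (Fin 6 → Bool) → (Fin 6 → Bool)) (i₀ : Fin 6)
    (hγa : ∀ i, i ≠ i₀ → IsDegLeFun 1 (fun u => γ u i)) (hγq : IsDegLeFun 2 (fun u => γ u i₀))
    (B : Fin r → (Fin 6 → Bool) → Bool) (hB : ∀ k, IsDegLeFun 2 (B k))
    (act : (Fin 6 → Bool) → (Fin r → Bool) → Fin r → Bool)
    (hact0 : ∀ u, act u (fun _ => false) = fun _ => false)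
    (tsec : Fin r → (Fin 6 → Bool) → Fin r → Bool) (htsec : ∀ a k, IsDegLeFun 1 (fun u => tsec a u k))
    (hhit : ∀ a u, act u (tsec a u) = fun k => decide (k = a))
    (c₁ c₂ : (Fin (6 + r) → Bool) → Bool) (h₁ : IsDegLeFun 3 c₁) (h₂ : IsDegLeFun 3 c₂)
    (h : ∀ (u : Fin 6 → Bool) (w : Fin r → Bool),
      (c₁ (Fin.append u w) ^^ c₂ (Fin.append (γ u) (fun k => act u w k ^^ B k u))) =
        decide (∀ i, u i = false)) :
    ∑ T ∈ (univ : Finset (Fin r)).powersetCard 2,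
      ind (coefC c₂ T (fun _ => false) ^^ coefC c₂ T (fun i => decide (i = i₀))) *
        ∑ u, (∏ m ∈ T, ind (B m u)) * ind (γ u i₀) = 1 := by
  refine zeroSection_parity_closed γ i₀ hγa hγq B hB c₁ c₂ h₁ h₂ tsec htsec (fun u => ?_) (fun a u => ?_)
  · -- zero section: `act u 0 = 0`
    have h' := h u (fun _ => false)
    rw [hact0 u] at h'
    simpa only [Bool.false_xor] using h'
  · -- section `a`: `act u (tsec_a u) = e_a`
    have h' := h u (tsec a u)
    rw [hhit a u] at h'
    exact h'

end Summit.QuantumAdvantage.QuantumAdvantage.Theorems.NearExactIsExact.Negative.ZeroSectionParity
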